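import Literature.NumberTheory.Automorphic.ArchTestFunctionSpace
import Literature.NumberTheory.Automorphic.AutomorphicQuotientKernelConvolution
import Literature.NumberTheory.Automorphic.GLnIwasawaIntegration
import Literature.Analysis.Calculus.SmoothKernelIntegral
import HarnessLib

/-!
# Convolution of test functions on `G_∞ = GL_n(K_∞)`: `f ⋆ g^*` is a test function, its left and
# right derivatives, and Dirac (approximate identity) estimates

Topic `NumberTheory/Automorphic`; namespace `Literature.NumberTheory.Automorphic`. The elementary
calculus of the convolution algebra `C_c^∞(G_∞)` needed for the bi-Whittaker distributions of
`ArchWhittakerBiDistribution` (Shalika (1974), §3; Getz–Hahn (2024), §4.2), with the tree's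
multiplicative convolution `mulConv μ f₁ f₂ = ∫ f₁(u) f₂(u⁻¹ ·) dμ(u)` and involution
`mulStar g = \overline{g((·)⁻¹)}` (`AutomorphicQuotientKernelConvolution`) for the Haar measure
`archHaar` of `ArchGardingWhittaker`:

* `archExtZero f` — the extension BY ZERO of a function on `GL_n(K_∞)` to all matrices; for a test
  function it is `C^∞` on `M_n(K_∞)` (`IsArchTestFunction.contDiff_archExtZero`: smooth at invertible
  matrices by `contDiffAt_extend_of_isArchSmooth`, locally zero at singular ones as the support is a
  compact set of invertible matrices);
* `mulConv_mulStar_apply'` — `(f ⋆ g^*)(z) = ∫ f(z y) \overline{g(y)} dy`;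
* `IsArchTestFunction.mulConv_mulStar` — **`f ⋆ g^*` is a test function** for `f` a test function and
  `g` continuous of compact support (smoothness of the exponential slices
  `Y ↦ ∫ f̃(z e^Y y) \overline{g(y)} dy` by differentiation under the integral sign,
  `Literature.Analysis.Calculus.contDiff_integral_kernel_mul`);
* `archLeftDeriv_mulConv_mulStar` — **`L_X (f ⋆ g^*) = (L_X f) ⋆ g^*`** (left translations commute with
  right convolution), and its word version;
* `mulConv_mulStar_archLeftDeriv` — **`f ⋆ (L_X g)^* = R_X (f ⋆ g^*)`** (integration by parts along
  `y ↦ exp(sX) y`), and its word version `f ⋆ (L_w g)^* = R_w (f ⋆ g^*)`;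
* `archRightDeriv_mulConv_mulStar_eq_sum` — **`R_X (f ⋆ g^*) = Σ_b (R_{X_b} f) ⋆ (c_b g)^*`** in a real
  basis `(X_b)` of `𝔤𝔩_n(K_∞)`, `c_b(y)` the `b`-coordinate of `y⁻¹ X y` (right translation twists
  `R_X` by `Ad(y⁻¹)`), and its word version `archRightWordDeriv_mulConv_mulStar_eq_sum`;
* `norm_mulConv_mulStar_sub_le`, `exists_compact_forall_eps_nhds` — **Dirac estimates**: for a
  probability weight `β ≥ 0` supported in `U`,
  `|(G ⋆ (c β)^*)(z) - c(1) G(z)| ≤ sup_{y ∈ U} |c(y) G(z y) - c(1) G(z)|`, and the latter is uniformly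
  small, with uniformly compact support, for `U` small (uniform continuity on compacta).

Everything is proved; the only definitions are `archExtZero` and the coordinate functional `adCoord`.

## References

* J. A. Shalika, *The multiplicity one theorem for `GL_n`*, Ann. of Math. 100 (1974), §3 [Shalika1974].
* J. R. Getz, H. Hahn, *An Introduction to Automorphic Representations* (2024), §4.2 [GetzHahn2024].
* A. Deitmar, S. Echterhoff, *Principles of harmonic analysis* (2014), §1.6, Prop. 6.2.1
  [DeitmarEchterhoff2014].
-/

noncomputable section

open MeasureTheory Measure NumberField NumberField.mixedEmbedding IsDedekindDomain Set Filter
open scoped MatrixGroups Topology Classical ContDiff Matrix.Norms.Operator ComplexConjugate Matrix Pointwise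

namespace Literature.NumberTheory.Automorphic

variable {n : ℕ} {K : Type} [Field K] [NumberField K]

attribute [local instance] glInfBorel borelSpace_glInf locallyCompactSpace_glInf
  secondCountableTopology_glInf

-- Mathlib idiom (Mathlib/Algebra/Lie/OfAssociative.lean): the commutator Lie ring on matrices
attribute [local instance 100] LieRing.ofAssociativeRing

-- as in `ArchGardingWhittaker`: the scoped `L∞`-operator normed ring structure on matrices is only
-- reducibly defeq to the Pi uniformity
set_option backward.isDefEq.respectTransparency false

local notation "Mat" => Matrix (Fin n) (Fin n) (mixedSpace K)
local notation "G∞" => GL (Fin n) (mixedSpace K)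

/-! ### 1. The extension by zero of a test function is smooth on all matrices -/

section ExtZero

/-- **The extension by zero** `f₀(M) = f(M)` for invertible `M` and `0` otherwise, of a function on
`GL_n(K_∞)` to `M_n(K_∞)`. [folklore] -/
def archExtZero (f : G∞ → ℂ) (M : Mat) : ℂ :=
  if h : IsUnit M then f h.unit else 0

omit [NumberField K] in
/-- `f₀(y) = f(y)` on invertible matrices. [folklore] -/
@[simp] theorem archExtZero_coe (f : G∞ → ℂ) (y : G∞) : archExtZero f (y : Mat) = f y := by
  simp only [archExtZero, dif_pos (Units.isUnit y), IsUnit.unit_of_val_units]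

omit [NumberField K] in
/-- The image in `M_n(K_∞)` of the support of a compactly supported function on `GL_n(K_∞)` is compact,
hence closed, and consists of invertible matrices. [folklore] -/
theorem isClosed_image_val_tsupport {f : G∞ → ℂ} (hf : HasCompactSupport f) :
    IsClosed ((Units.val : G∞ → Mat) '' tsupport f) :=
  (hf.isCompact.image Units.continuous_val).isClosed

/-- **The extension by zero of a test function is `C^∞` on `M_n(K_∞)`**: at an invertible matrix it
agrees near the point with the extension of `contDiffAt_extend_of_isArchSmooth`, and at a singular
matrix it vanishes near the point (the support is a compact set of invertible matrices). [folklore] -/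
theorem IsArchTestFunction.contDiff_archExtZero {f : G∞ → ℂ} (hf : IsArchTestFunction n K f) :
    ContDiff ℝ ∞ (archExtZero f) := by
  classical
  refine contDiff_iff_contDiffAt.2 fun M₀ => ?_
  by_cases hM₀ : IsUnit M₀
  · -- near an invertible matrix, `f₀` is the smooth extension `α̃`
    obtain ⟨y₀, rfl⟩ := hM₀
    have hopen : IsOpen (range (Units.val : G∞ → Mat)) :=
      (Units.isOpenEmbedding_val (R := Mat)).isOpen_range
    have hev : archExtZero f =ᶠ[𝓝 (y₀ : Mat)] fun M : Mat => f (if h : IsUnit M then h.unit else 1) := by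
      filter_upwards [hopen.mem_nhds ⟨y₀, rfl⟩] with M hM
      obtain ⟨y, rfl⟩ := hM
      simp only [archExtZero, dif_pos (Units.isUnit y)]
    exact (hf.contDiffAt_archExt y₀).congr_of_eventuallyEq hev
  · -- near a singular matrix, `f₀ = 0`
    have hclosed := isClosed_image_val_tsupport hf.hasCompactSupport
    have hnot : M₀ ∉ (Units.val : G∞ → Mat) '' tsupport f := by
      rintro ⟨y, -, rfl⟩
      exact hM₀ (Units.isUnit y)
    have hev : archExtZero f =ᶠ[𝓝 M₀] fun _ => (0 : ℂ) := by
      filter_upwards [hclosed.isOpen_compl.mem_nhds hnot] with M hM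
      by_cases hM' : IsUnit M
      · rw [archExtZero, dif_pos hM']
        refine image_eq_zero_of_notMem_tsupport fun hmem => hM ⟨hM'.unit, hmem, hM'.unit_spec⟩
      · rw [archExtZero, dif_neg hM']
    exact contDiffAt_const.congr_of_eventuallyEq hev

end ExtZero

/-! ### 2. The convolution `f ⋆ g^*` and its smoothness -/

section Conv

/-- **`(f ⋆ g^*)(z) = ∫ f(z y) \overline{g(y)} dy`** (substitution `u = z y` in
`∫ f(u) \overline{g(z⁻¹ u)} du`, left invariance of the Haar measure). [folklore] -/
theorem mulConv_mulStar_apply' (f g : G∞ → ℂ) (z : G∞) :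
    mulConv (archHaar n K) f (mulStar g) z = ∫ y, f (z * y) * conj (g y) ∂(archHaar n K) := by
  rw [mulConv_apply, ← integral_mul_left_eq_self _ z]
  refine integral_congr_ae (Eventually.of_forall fun y => ?_)
  simp only [mulStar_apply, mul_inv_rev, inv_mul_cancel_right, inv_inv]

/-- The integrand of `(f ⋆ g^*)(z)` vanishes off `tsupport g`. [folklore] -/
theorem mulConv_mulStar_eq_setIntegral (f g : G∞ → ℂ) (z : G∞) :
    mulConv (archHaar n K) f (mulStar g) z = ∫ y in tsupport g, f (z * y) * conj (g y) ∂(archHaar n K) := by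
  rw [mulConv_mulStar_apply', setIntegral_eq_integral_of_forall_compl_eq_zero]
  intro y hy
  rw [image_eq_zero_of_notMem_tsupport hy, map_zero, mul_zero]

/-- `f ⋆ g^*` is continuous for `f, g` continuous of compact support. [folklore] -/
theorem continuous_mulConv_mulStar {f g : G∞ → ℂ} (hf : Continuous f) (hfs : HasCompactSupport f)
    (hg : Continuous g) : Continuous (mulConv (archHaar n K) f (mulStar g)) :=
  continuous_mulConv (archHaar n K) hf hfs (continuous_mulStar hg)

/-- `f ⋆ g^*` has compact support for `f, g` of compact support. [folklore] -/
theorem hasCompactSupport_mulConv_mulStar {f g : G∞ → ℂ} (hfs : HasCompactSupport f)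
    (hgs : HasCompactSupport g) : HasCompactSupport (mulConv (archHaar n K) f (mulStar g)) :=
  hasCompactSupport_mulConv (archHaar n K) hfs (hasCompactSupport_mulStar hgs)

/-- **`f ⋆ g^*` is smooth in the archimedean variable** for `f` a test function and `g` continuous of
compact support: the exponential slice `Y ↦ (f ⋆ g^*)(z e^Y) = ∫_{supp g} f₀(z e^Y y) \overline{g(y)} dy`
is an integral against the `C^∞` kernel `(Y, M) ↦ f₀(z e^Y M)` evaluated along the bounded map
`y ↦ (y : M_n(K_∞))` (`contDiff_integral_kernel_mul`). [folklore] -/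
theorem IsArchTestFunction.isArchSmooth_mulConv_mulStar {f g : G∞ → ℂ} (hf : IsArchTestFunction n K f)
    (hg : Continuous g) (hgs : HasCompactSupport g) :
    IsArchSmooth (archGroupGL n K).carrier.subtype (mulConv (archHaar n K) f (mulStar g)) := by
  refine IsArchTestFunction.isArchSmooth_of_contDiff_slice fun z => ?_
  -- the smooth kernel `A(Y, M) = f₀(z e^Y M)`
  set A : Mat × Mat → ℂ := fun p => archExtZero f ((z : Mat) * NormedSpace.exp p.1 * p.2) with hA
  have hexp : ContDiff ℝ ∞ (NormedSpace.exp : Mat → Mat) :=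
    contDiff_iff_contDiffAt.2 fun x => Literature.Analysis.Calculus.contDiffAt_exp x
  have hAs : ContDiff ℝ ∞ A :=
    hf.contDiff_archExtZero.comp ((contDiff_const.mul (hexp.comp contDiff_fst)).mul contDiff_snd)
  -- the restricted measure and the bounded map `y ↦ (y : Mat)`
  set ν : Measure G∞ := (archHaar n K).restrict (tsupport g) with hν
  obtain ⟨R, hR⟩ := (hgs.isCompact.image Units.continuous_val).isBounded.subset_closedBall (0 : Mat)
  have hmR : ∀ᵐ y ∂ν, ‖((y : G∞) : Mat)‖ ≤ R := by
    refine (ae_restrict_iff' (isClosed_tsupport g).measurableSet).2 (ae_of_all _ fun y hy => ?_)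
    have h := hR ⟨y, hy, rfl⟩
    rwa [Metric.mem_closedBall, dist_zero_right] at h
  have hgs' : HasCompactSupport fun y : G∞ => conj (g y) := hgs.comp_left (map_zero _)
  have hF : Integrable (fun y : G∞ => conj (g y)) ν :=
    ((Complex.continuous_conj.comp hg).integrable_of_hasCompactSupport hgs').restrict
  have hsmooth := Literature.Analysis.Calculus.contDiff_integral_kernel_mul hAs
    (Units.continuous_val.aestronglyMeasurable) hmR hF
  -- identify with the exponential slice
  have hident : (fun M : Mat => mulConv (archHaar n K) f (mulStar g) (z * expGL M)) =
      fun M => ∫ y, A (M, ((y : G∞) : Mat)) * conj (g y) ∂ν := by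
    funext M
    rw [mulConv_mulStar_eq_setIntegral]
    refine integral_congr_ae (ae_of_all _ fun y => ?_)
    simp only [hA]
    congr 1
    rw [← coe_expGL, ← Units.val_mul, ← Units.val_mul, archExtZero_coe]
  rw [hident]
  exact hsmooth

/-- **`f ⋆ g^*` is a test function** for `f` a test function and `g` continuous of compact support.
[folklore] -/
theorem IsArchTestFunction.mulConv_mulStar {f g : G∞ → ℂ} (hf : IsArchTestFunction n K f)
    (hg : Continuous g) (hgs : HasCompactSupport g) :
    IsArchTestFunction n K (mulConv (archHaar n K) f (mulStar g)) :=
  ⟨continuous_mulConv_mulStar hf.continuous hf.hasCompactSupport hg,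
    hasCompactSupport_mulConv_mulStar hf.hasCompactSupport hgs, hf.isArchSmooth_mulConv_mulStar hg hgs⟩

end Conv

/-! ### 3. Left derivatives: `L_X (f ⋆ g^*) = (L_X f) ⋆ g^*` -/

section LeftDeriv

omit [NumberField K] in
/-- A continuous function on `ℝ × G_∞` is bounded on `closedBall 0 1 × κ` for `κ` compact. [folklore] -/
theorem exists_bound_on_closedBall_prod {F : ℝ × G∞ → ℂ} (hF : Continuous F) {κ : Set G∞} (hκ : IsCompact κ) :
    ∃ M : ℝ, ∀ s ∈ Metric.closedBall (0 : ℝ) 1, ∀ y ∈ κ, ‖F (s, y)‖ ≤ M := by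
  obtain ⟨M, hM⟩ := ((isCompact_closedBall (0 : ℝ) 1).prod hκ).exists_bound_of_continuousOn hF.continuousOn
  exact ⟨M, fun s hs y hy => hM (s, y) (mk_mem_prod hs hy)⟩

/-- **`L_X (f ⋆ g^*) = (L_X f) ⋆ g^*`**: the derivative along left translations of the right
convolution `∫ f(z y) ḡ(y) dy` falls on `f` (differentiation under the integral sign over the compact
`supp g`; Deitmar–Echterhoff (2014), Lemma 1.6.3, `L_y(f * g) = (L_y f) * g`, in derivative form).
[folklore] -/
theorem archLeftDeriv_mulConv_mulStar {f g : G∞ → ℂ} (hf : IsArchTestFunction n K f) (hg : Continuous g)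
    (hgs : HasCompactSupport g) (X : Mat) :
    archLeftDeriv X (mulConv (archHaar n K) f (mulStar g)) = mulConv (archHaar n K) (archLeftDeriv X f) (mulStar g) := by
  funext z
  set ν : Measure G∞ := (archHaar n K).restrict (tsupport g) with hν
  haveI : IsFiniteMeasure ν := ⟨by
    rw [hν, Measure.restrict_apply_univ]
    exact hgs.isCompact.measure_lt_top⟩
  -- the integrand and its `s`-derivative
  set F : ℝ → G∞ → ℂ := fun s y => f ((expGL (s • X))⁻¹ * (z * y)) * conj (g y) with hF
  set F' : ℝ → G∞ → ℂ := fun s y => archLeftDeriv X f ((expGL (s • X))⁻¹ * (z * y)) * conj (g y) with hF'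
  have hflow : Continuous fun p : ℝ × G∞ => ((expGL (p.1 • X))⁻¹ * (z * p.2) : G∞) :=
    ((continuous_expGL_smul X).comp continuous_fst).inv.mul (continuous_const.mul continuous_snd)
  have hFc : Continuous fun p : ℝ × G∞ => F p.1 p.2 :=
    (hf.continuous.comp hflow).mul (Complex.continuous_conj.comp (hg.comp continuous_snd))
  have hF'c : Continuous fun p : ℝ × G∞ => F' p.1 p.2 :=
    ((hf.archLeftDeriv X).continuous.comp hflow).mul (Complex.continuous_conj.comp (hg.comp continuous_snd))
  obtain ⟨M, hM⟩ := exists_bound_on_closedBall_prod hF'c hgs.isCompact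
  have hmeas : ∀ s, AEStronglyMeasurable (F s) ν := fun s =>
    (hFc.comp (continuous_const.prodMk continuous_id)).aestronglyMeasurable
  have hint : Integrable (F 0) ν := by
    rw [hν]; exact (hFc.comp (continuous_const.prodMk continuous_id)).continuousOn.integrableOn_compact hgs.isCompact
  have hbound : ∀ᵐ y ∂ν, ∀ s ∈ Metric.ball (0 : ℝ) 1, ‖F' s y‖ ≤ M := by
    rw [hν, ae_restrict_iff' (isClosed_tsupport g).measurableSet]
    exact ae_of_all _ fun y hy s hs => hM s (Metric.ball_subset_closedBall hs) y hy
  have hdiff : ∀ᵐ y ∂ν, ∀ s ∈ Metric.ball (0 : ℝ) 1, HasDerivAt (fun s => F s y) (F' s y) s :=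
    ae_of_all _ fun y s _ => (hf.hasDerivAt_left X (z * y) s).mul_const _
  have key := (hasDerivAt_integral_of_dominated_loc_of_deriv_le (μ := ν) (Metric.ball_mem_nhds (0 : ℝ) one_pos)
    (Eventually.of_forall hmeas) hint ((hF'c.comp (continuous_const.prodMk continuous_id)).aestronglyMeasurable)
    hbound (integrable_const M) hdiff).2
  -- identify both sides
  have hLHS : (fun s : ℝ => mulConv (archHaar n K) f (mulStar g) ((expGL (s • X))⁻¹ * z)) = fun s => ∫ y, F s y ∂ν := by
    funext s
    rw [mulConv_mulStar_eq_setIntegral]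
    refine integral_congr_ae (ae_of_all _ fun y => ?_)
    simp only [hF, mul_assoc]
  have hRHS : ∫ y, F' 0 y ∂ν = mulConv (archHaar n K) (archLeftDeriv X f) (mulStar g) z := by
    rw [mulConv_mulStar_eq_setIntegral]
    refine integral_congr_ae (ae_of_all _ fun y => ?_)
    simp only [hF', zero_smul, expGL_zero, inv_one, one_mul]
  show deriv (fun s : ℝ => mulConv (archHaar n K) f (mulStar g) ((expGL (s • X))⁻¹ * z)) 0 = _
  rw [hLHS, key.deriv, hRHS]

/-- **`L_w (f ⋆ g^*) = (L_w f) ⋆ g^*`** for every word `w`. [folklore] -/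
theorem archLeftWordDeriv_mulConv_mulStar {f g : G∞ → ℂ} (hf : IsArchTestFunction n K f) (hg : Continuous g)
    (hgs : HasCompactSupport g) :
    ∀ w : List Mat, archLeftWordDeriv w (mulConv (archHaar n K) f (mulStar g)) =
      mulConv (archHaar n K) (archLeftWordDeriv w f) (mulStar g)
  | [] => rfl
  | X :: w => by
    rw [archLeftWordDeriv_cons, archLeftWordDeriv_mulConv_mulStar hf hg hgs w, archLeftWordDeriv_cons,
      archLeftDeriv_mulConv_mulStar (hf.archLeftWordDeriv w) hg hgs X]

end LeftDeriv

/-! ### 4. Integration by parts: `f ⋆ (L_X g)^* = R_X (f ⋆ g^*)` -/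

section Parts

/-- `(f ⋆ g^*)(z exp(sX)) = ∫ f(z y) \overline{g(exp(-sX) y)} dy` (substitution `y ↦ exp(-sX) y`). [folklore] -/
theorem mulConv_mulStar_mul_expGL (f g : G∞ → ℂ) (z : G∞) (X : Mat) (s : ℝ) :
    mulConv (archHaar n K) f (mulStar g) (z * expGL (s • X)) =
      ∫ y, f (z * y) * conj (g ((expGL (s • X))⁻¹ * y)) ∂(archHaar n K) := by
  rw [mulConv_mulStar_apply', ← integral_mul_left_eq_self _ (expGL (s • X))⁻¹]
  refine integral_congr_ae (Eventually.of_forall fun y => ?_)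
  simp only [mul_assoc, mul_inv_cancel_left]

/-- Complex conjugation commutes with real derivatives: if `φ` has derivative `φ'` then `conj ∘ φ` has
derivative `conj φ'`. [folklore] -/
theorem HasDerivAt.cconj {φ : ℝ → ℂ} {φ' : ℂ} {s : ℝ} (h : HasDerivAt φ φ' s) :
    HasDerivAt (fun t => conj (φ t)) (conj φ') s := by
  have h2 := (Complex.conjCLE.toContinuousLinearMap.hasFDerivAt (x := φ s)).comp_hasDerivAt s h
  exact h2

/-- **`f ⋆ (L_X g)^* = R_X (f ⋆ g^*)`** for `f` continuous of compact support and `g` a test function: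
`(f ⋆ g^*)(z e^{sX}) = ∫ f(z y) \overline{g(e^{-sX} y)} dy` (`mulConv_mulStar_mul_expGL`), whose
`s`-derivative at `0` is `∫ f(z y) \overline{(L_X g)(y)} dy` (differentiation under the integral sign over
the compact `z⁻¹ supp f`). Integration by parts for the convolution algebra, Deitmar–Echterhoff (2014),
Lemma 1.6.3. [folklore] -/
theorem mulConv_mulStar_archLeftDeriv {f g : G∞ → ℂ} (hf : Continuous f) (hfs : HasCompactSupport f)
    (hg : IsArchTestFunction n K g) (X : Mat) :
    mulConv (archHaar n K) f (mulStar (archLeftDeriv X g)) = archRightDeriv X (mulConv (archHaar n K) f (mulStar g)) := by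
  funext z
  -- the compact set `z⁻¹ supp f` carrying the integrands
  set κ : Set G∞ := (fun y => z⁻¹ * y) '' tsupport f with hκ
  have hκc : IsCompact κ := hfs.isCompact.image (continuous_const.mul continuous_id)
  have hκcl : IsClosed κ := hκc.isClosed
  have hvan : ∀ y, y ∉ κ → f (z * y) = 0 := fun y hy =>
    image_eq_zero_of_notMem_tsupport fun h => hy ⟨z * y, h, inv_mul_cancel_left z y⟩
  set ν : Measure G∞ := (archHaar n K).restrict κ with hν
  haveI : IsFiniteMeasure ν := ⟨by rw [hν, Measure.restrict_apply_univ]; exact hκc.measure_lt_top⟩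
  set F : ℝ → G∞ → ℂ := fun s y => f (z * y) * conj (g ((expGL (s • X))⁻¹ * y)) with hF
  set F' : ℝ → G∞ → ℂ := fun s y => f (z * y) * conj (archLeftDeriv X g ((expGL (s • X))⁻¹ * y)) with hF'
  have hflow : Continuous fun p : ℝ × G∞ => ((expGL (p.1 • X))⁻¹ * p.2 : G∞) :=
    ((continuous_expGL_smul X).comp continuous_fst).inv.mul continuous_snd
  have hfz : Continuous fun p : ℝ × G∞ => f (z * p.2) := hf.comp (continuous_const.mul continuous_snd)
  have hFc : Continuous fun p : ℝ × G∞ => F p.1 p.2 :=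
    hfz.mul (Complex.continuous_conj.comp (hg.continuous.comp hflow))
  have hF'c : Continuous fun p : ℝ × G∞ => F' p.1 p.2 :=
    hfz.mul (Complex.continuous_conj.comp ((hg.archLeftDeriv X).continuous.comp hflow))
  obtain ⟨M, hM⟩ := exists_bound_on_closedBall_prod hF'c hκc
  have hmeas : ∀ s, AEStronglyMeasurable (F s) ν := fun s =>
    (hFc.comp (continuous_const.prodMk continuous_id)).aestronglyMeasurable
  have hint : Integrable (F 0) ν := by
    rw [hν]; exact (hFc.comp (continuous_const.prodMk continuous_id)).continuousOn.integrableOn_compact hκc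
  have hbound : ∀ᵐ y ∂ν, ∀ s ∈ Metric.ball (0 : ℝ) 1, ‖F' s y‖ ≤ M := by
    rw [hν, ae_restrict_iff' hκcl.measurableSet]
    exact ae_of_all _ fun y hy s hs => hM s (Metric.ball_subset_closedBall hs) y hy
  have hdiff : ∀ᵐ y ∂ν, ∀ s ∈ Metric.ball (0 : ℝ) 1, HasDerivAt (fun s => F s y) (F' s y) s :=
    ae_of_all _ fun y s _ => (HasDerivAt.cconj (hg.hasDerivAt_left X y s)).const_mul _
  have key := (hasDerivAt_integral_of_dominated_loc_of_deriv_le (μ := ν) (Metric.ball_mem_nhds (0 : ℝ) one_pos)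
    (Eventually.of_forall hmeas) hint ((hF'c.comp (continuous_const.prodMk continuous_id)).aestronglyMeasurable)
    hbound (integrable_const M) hdiff).2
  -- identify both sides
  have hLHS : (fun s : ℝ => mulConv (archHaar n K) f (mulStar g) (z * expGL (s • X))) = fun s => ∫ y, F s y ∂ν := by
    funext s
    rw [mulConv_mulStar_mul_expGL, hν, setIntegral_eq_integral_of_forall_compl_eq_zero]
    intro y hy
    change f (z * y) * conj (g ((expGL (s • X))⁻¹ * y)) = 0
    rw [hvan y hy, zero_mul]
  have hRHS : ∫ y, F' 0 y ∂ν = mulConv (archHaar n K) f (mulStar (archLeftDeriv X g)) z := by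
    rw [mulConv_mulStar_apply', hν, setIntegral_eq_integral_of_forall_compl_eq_zero]
    · refine integral_congr_ae (ae_of_all _ fun y => ?_)
      simp only [hF', zero_smul, expGL_zero, inv_one, one_mul]
    · intro y hy
      change f (z * y) * conj (archLeftDeriv X g ((expGL ((0 : ℝ) • X))⁻¹ * y)) = 0
      rw [hvan y hy, zero_mul]
  symm
  show deriv (fun s : ℝ => mulConv (archHaar n K) f (mulStar g) (z * expGL (s • X))) 0 = _
  rw [hLHS, key.deriv, hRHS]

/-- **`f ⋆ (L_w g)^* = R_w (f ⋆ g^*)`** for every word `w`. [folklore] -/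
theorem mulConv_mulStar_archLeftWordDeriv {f g : G∞ → ℂ} (hf : Continuous f) (hfs : HasCompactSupport f)
    (hg : IsArchTestFunction n K g) :
    ∀ w : List Mat, mulConv (archHaar n K) f (mulStar (archLeftWordDeriv w g)) =
      archRightWordDeriv w (mulConv (archHaar n K) f (mulStar g))
  | [] => rfl
  | X :: w => by
    rw [archLeftWordDeriv_cons, mulConv_mulStar_archLeftDeriv hf hfs (hg.archLeftWordDeriv w) X,
      mulConv_mulStar_archLeftWordDeriv hf hfs hg w, archRightWordDeriv_cons]

end Parts

/-! ### 5. Right derivatives: `R_X (f ⋆ g^*) = Σ_b (R_{X_b} f) ⋆ (c_b g)^*` -/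

section RightDeriv

variable (n K) in
/-- A real basis of `𝔤𝔩_n(K_∞)` (Mathlib's `Module.finBasis`), through which the `Ad`-twist of the right
derivatives under right translation is expanded. [folklore] -/
def glBasis : Module.Basis (Fin (Module.finrank ℝ (Matrix (Fin n) (Fin n) (mixedSpace K)))) ℝ
    (Matrix (Fin n) (Fin n) (mixedSpace K)) :=
  Module.finBasis ℝ _

/-- **The coordinate functions of `Ad(y⁻¹) X`**: `adCoord X b y` is the `b`-th coordinate of
`y⁻¹ X y` in the basis `glBasis`. [folklore] -/
def adCoord (X : Mat) (b : Fin (Module.finrank ℝ Mat)) (y : G∞) : ℝ :=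
  (glBasis n K).repr (((y⁻¹ : G∞) : Mat) * X * (y : Mat)) b

/-- `adCoord X b` is continuous. [folklore] -/
theorem continuous_adCoord (X : Mat) (b : Fin (Module.finrank ℝ Mat)) : Continuous (adCoord X b) := by
  have hrepr : Continuous fun M : Mat => (glBasis n K).repr M b :=
    (((glBasis n K).coord b).continuous_of_finiteDimensional)
  exact hrepr.comp ((Units.continuous_coe_inv.mul continuous_const).mul Units.continuous_val)

/-- `y⁻¹ X y = Σ_b adCoord X b y • X_b`. [folklore] -/
theorem sum_adCoord_smul (X : Mat) (y : G∞) :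
    ∑ b, adCoord X b y • (glBasis n K b) = ((y⁻¹ : G∞) : Mat) * X * (y : Mat) :=
  (glBasis n K).sum_repr _

/-- `adCoord X b 1 • X_b` sums to `X`. [folklore] -/
theorem sum_adCoord_one_smul (X : Mat) : ∑ b, adCoord X b (1 : G∞) • (glBasis n K b) = X := by
  rw [sum_adCoord_smul, inv_one, Units.val_one, Matrix.one_mul, Matrix.mul_one]

/-- **The `Ad`-twist expanded**: `R_X (f(· y))(z) = Σ_b adCoord X b y · (R_{X_b} f)(z y)`. [folklore] -/
theorem archRightDeriv_comp_mul_right_eq_sum {f : G∞ → ℂ} (hf : IsArchTestFunction n K f) (X : Mat) (y z : G∞) :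
    archRightDeriv X (fun h => f (h * y)) z = ∑ b, (adCoord X b y : ℂ) * archRightDeriv (glBasis n K b) f (z * y) := by
  rw [archRightDeriv_comp_mul_right, ← sum_adCoord_smul X y, hf.archRightDeriv_sum_smul_left]
  simp only [Finset.sum_apply, Pi.smul_apply, smul_eq_mul]

/-- A finite sum of test functions is a test function. [folklore] -/
theorem IsArchTestFunction.finset_sum {ι' : Type*} (s : Finset ι') {F : ι' → G∞ → ℂ}
    (hF : ∀ i ∈ s, IsArchTestFunction n K (F i)) : IsArchTestFunction n K (∑ i ∈ s, F i) := by
  classical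
  induction s using Finset.induction_on with
  | empty => simpa using IsArchTestFunction.zero
  | insert j t hj iht =>
    rw [Finset.sum_insert hj]
    exact (hF j (Finset.mem_insert_self j t)).add (iht fun k hk => hF k (Finset.mem_insert_of_mem hk))

/-- `R_X` of a finite sum of test functions. [folklore] -/
theorem archRightDeriv_finset_sum {ι' : Type*} (s : Finset ι') {F : ι' → G∞ → ℂ}
    (hF : ∀ i ∈ s, IsArchTestFunction n K (F i)) (X : Mat) :
    archRightDeriv X (∑ i ∈ s, F i) = ∑ i ∈ s, archRightDeriv X (F i) := by
  classical
  induction s using Finset.induction_on with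
  | empty =>
    funext y
    simp only [Finset.sum_empty]
    exact deriv_const (0 : ℝ) (0 : ℂ)
  | insert i s hi ih =>
    have hs : ∀ j ∈ s, IsArchTestFunction n K (F j) := fun j hj => hF j (Finset.mem_insert_of_mem hj)
    rw [Finset.sum_insert hi, Finset.sum_insert hi,
      (hF i (Finset.mem_insert_self i s)).archRightDeriv_add (IsArchTestFunction.finset_sum s hs) X, ih hs]

/-- **`R_X (f ⋆ g^*) = Σ_b (R_{X_b} f) ⋆ (c_b g)^*`** with `c_b = adCoord X b`: the right derivative
of `∫ f(z y) ḡ(y) dy` is `∫ (R_X f(· y))(z) ḡ(y) dy = Σ_b ∫ c_b(y) (R_{X_b} f)(z y) ḡ(y) dy`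
(differentiation under the integral sign over the compact `supp g`; right translation twists `R_X` by
`Ad(y⁻¹)`). [folklore] -/
theorem archRightDeriv_mulConv_mulStar_eq_sum {f g : G∞ → ℂ} (hf : IsArchTestFunction n K f) (hg : Continuous g)
    (hgs : HasCompactSupport g) (X : Mat) :
    archRightDeriv X (mulConv (archHaar n K) f (mulStar g)) =
      ∑ b, mulConv (archHaar n K) (archRightDeriv (glBasis n K b) f)
        (mulStar fun y => (adCoord X b y : ℂ) * g y) := by
  funext z
  set ν : Measure G∞ := (archHaar n K).restrict (tsupport g) with hν
  haveI : IsFiniteMeasure ν := ⟨by rw [hν, Measure.restrict_apply_univ]; exact hgs.isCompact.measure_lt_top⟩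
  set F : ℝ → G∞ → ℂ := fun s y => f (z * expGL (s • X) * y) * conj (g y) with hF
  set F' : ℝ → G∞ → ℂ := fun s y =>
    (∑ b, (adCoord X b y : ℂ) * archRightDeriv (glBasis n K b) f (z * expGL (s • X) * y)) * conj (g y) with hF'
  have hflow : Continuous fun p : ℝ × G∞ => (z * expGL (p.1 • X) * p.2 : G∞) :=
    (continuous_const.mul ((continuous_expGL_smul X).comp continuous_fst)).mul continuous_snd
  have hFc : Continuous fun p : ℝ × G∞ => F p.1 p.2 :=
    (hf.continuous.comp hflow).mul (Complex.continuous_conj.comp (hg.comp continuous_snd))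
  have hF'c : Continuous fun p : ℝ × G∞ => F' p.1 p.2 := by
    refine Continuous.mul ?_ (Complex.continuous_conj.comp (hg.comp continuous_snd))
    refine continuous_finsetSum _ fun b _ => ?_
    exact (Complex.continuous_ofReal.comp ((continuous_adCoord X b).comp continuous_snd)).mul
      ((hf.archRightDeriv _).continuous.comp hflow)
  obtain ⟨M, hM⟩ := exists_bound_on_closedBall_prod hF'c hgs.isCompact
  have hmeas : ∀ s, AEStronglyMeasurable (F s) ν := fun s =>
    (hFc.comp (continuous_const.prodMk continuous_id)).aestronglyMeasurable
  have hint : Integrable (F 0) ν := by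
    rw [hν]; exact (hFc.comp (continuous_const.prodMk continuous_id)).continuousOn.integrableOn_compact hgs.isCompact
  have hbound : ∀ᵐ y ∂ν, ∀ s ∈ Metric.ball (0 : ℝ) 1, ‖F' s y‖ ≤ M := by
    rw [hν, ae_restrict_iff' (isClosed_tsupport g).measurableSet]
    exact ae_of_all _ fun y hy s hs => hM s (Metric.ball_subset_closedBall hs) y hy
  have hdiff : ∀ᵐ y ∂ν, ∀ s ∈ Metric.ball (0 : ℝ) 1, HasDerivAt (fun s => F s y) (F' s y) s := by
    refine ae_of_all _ fun y s _ => ?_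
    -- `s ↦ f(z e^{sX} y) = f_y(z e^{sX})` with `f_y = f(· y)`
    have h1 := (hf.comp_mul_right y).hasDerivAt_right X z s
    have h2 : archRightDeriv X (fun h => f (h * y)) (z * expGL (s • X)) =
        ∑ b, (adCoord X b y : ℂ) * archRightDeriv (glBasis n K b) f (z * expGL (s • X) * y) :=
      archRightDeriv_comp_mul_right_eq_sum hf X y _
    rw [h2] at h1
    exact h1.mul_const _
  have key := (hasDerivAt_integral_of_dominated_loc_of_deriv_le (μ := ν) (Metric.ball_mem_nhds (0 : ℝ) one_pos)
    (Eventually.of_forall hmeas) hint ((hF'c.comp (continuous_const.prodMk continuous_id)).aestronglyMeasurable)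
    hbound (integrable_const M) hdiff).2
  have hLHS : (fun s : ℝ => mulConv (archHaar n K) f (mulStar g) (z * expGL (s • X))) = fun s => ∫ y, F s y ∂ν := by
    funext s
    rw [mulConv_mulStar_eq_setIntegral]
  have hRHS : ∫ y, F' 0 y ∂ν = ∑ b, mulConv (archHaar n K) (archRightDeriv (glBasis n K b) f)
      (mulStar fun y => (adCoord X b y : ℂ) * g y) z := by
    have h1 : ∀ b, mulConv (archHaar n K) (archRightDeriv (glBasis n K b) f) (mulStar fun y => (adCoord X b y : ℂ) * g y) z =
        ∫ y, (adCoord X b y : ℂ) * archRightDeriv (glBasis n K b) f (z * y) * conj (g y) ∂ν := by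
      intro b
      rw [mulConv_mulStar_apply', hν, setIntegral_eq_integral_of_forall_compl_eq_zero]
      · refine integral_congr_ae (ae_of_all _ fun y => ?_)
        simp only [map_mul, Complex.conj_ofReal]
        ring
      · intro y hy
        simp [image_eq_zero_of_notMem_tsupport hy]
    simp only [h1]
    rw [← integral_finsetSum]
    · refine integral_congr_ae (ae_of_all _ fun y => ?_)
      simp only [hF', zero_smul, expGL_zero, mul_one, Finset.sum_mul]
    · intro b _
      have hc : Continuous fun y : G∞ => (adCoord X b y : ℂ) * archRightDeriv (glBasis n K b) f (z * y) * conj (g y) :=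
        ((Complex.continuous_ofReal.comp (continuous_adCoord X b)).mul
          ((hf.archRightDeriv _).continuous.comp (continuous_const.mul continuous_id))).mul
          (Complex.continuous_conj.comp hg)
      rw [hν]
      exact hc.continuousOn.integrableOn_compact hgs.isCompact
  show deriv (fun s : ℝ => mulConv (archHaar n K) f (mulStar g) (z * expGL (s • X))) 0 = _
  rw [hLHS, key.deriv, hRHS, Finset.sum_apply]

/-- **`R_w (f ⋆ g^*)` expanded**, for the word `w = [X₀, …, X_{k-1}]`:
`R_w (f ⋆ g^*) = Σ_{v : Fin k → B} (R_{[X_{v 0}, …]} f) ⋆ (c_v g)^*` with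
`c_v(y) = ∏_j adCoord X_j (v j) y` (`archRightDeriv_mulConv_mulStar_eq_sum` iterated). [folklore] -/
theorem archRightWordDeriv_mulConv_mulStar_eq_sum {f g : G∞ → ℂ} (hf : IsArchTestFunction n K f) (hg : Continuous g)
    (hgs : HasCompactSupport g) :
    ∀ (k : ℕ) (X : Fin k → Mat),
      archRightWordDeriv (List.ofFn X) (mulConv (archHaar n K) f (mulStar g)) =
        ∑ v : Fin k → Fin (Module.finrank ℝ Mat),
          mulConv (archHaar n K) (archRightWordDeriv (List.ofFn fun j => glBasis n K (v j)) f)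
            (mulStar fun y => ((∏ j, adCoord (X j) (v j) y : ℝ) : ℂ) * g y)
  | 0, X => by
    rw [List.ofFn_zero, archRightWordDeriv_nil]
    rw [Fintype.sum_unique]
    simp only [List.ofFn_zero, archRightWordDeriv_nil, Finset.univ_eq_empty, Finset.prod_empty, Complex.ofReal_one,
      one_mul]
  | k + 1, X => by
    rw [List.ofFn_succ, archRightWordDeriv_cons, archRightWordDeriv_mulConv_mulStar_eq_sum hf hg hgs k (fun i => X i.succ)]
    -- `R_{X 0}` of the sum, term by term
    have hterm : ∀ v : Fin k → Fin (Module.finrank ℝ Mat), IsArchTestFunction n K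
        (mulConv (archHaar n K) (archRightWordDeriv (List.ofFn fun j => glBasis n K (v j)) f)
          (mulStar fun y => ((∏ j, adCoord (X j.succ) (v j) y : ℝ) : ℂ) * g y)) := fun v =>
      (hf.archRightWordDeriv _).mulConv_mulStar
        ((Complex.continuous_ofReal.comp (continuous_finsetProd _ fun j _ => continuous_adCoord _ _)).mul hg)
        (hgs.mul_left)
    rw [archRightDeriv_finset_sum _ (fun v _ => hterm v)]
    have hstep : ∀ v : Fin k → Fin (Module.finrank ℝ Mat),
        archRightDeriv (X 0) (mulConv (archHaar n K) (archRightWordDeriv (List.ofFn fun j => glBasis n K (v j)) f)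
          (mulStar fun y => ((∏ j, adCoord (X j.succ) (v j) y : ℝ) : ℂ) * g y)) =
        ∑ b, mulConv (archHaar n K) (archRightDeriv (glBasis n K b) (archRightWordDeriv (List.ofFn fun j => glBasis n K (v j)) f))
          (mulStar fun y => (adCoord (X 0) b y : ℂ) * (((∏ j, adCoord (X j.succ) (v j) y : ℝ) : ℂ) * g y)) := fun v =>
      archRightDeriv_mulConv_mulStar_eq_sum (hf.archRightWordDeriv _)
        ((Complex.continuous_ofReal.comp (continuous_finsetProd _ fun j _ => continuous_adCoord _ _)).mul hg)
        hgs.mul_left (X 0)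
    simp only [hstep]
    -- reindex `Σ_v Σ_b` as `Σ_{cons b v}`
    rw [Finset.sum_comm, ← (Fin.consEquiv fun _ => Fin (Module.finrank ℝ Mat)).sum_comp, Fintype.sum_prod_type]
    refine Finset.sum_congr rfl fun b _ => Finset.sum_congr rfl fun v _ => ?_
    simp only [Fin.consEquiv_apply]
    congr 1
    · rw [List.ofFn_succ, archRightWordDeriv_cons]
      simp only [Fin.cons_zero, Fin.cons_succ]
    · funext y
      rw [mulStar_apply, mulStar_apply, Fin.prod_univ_succ]
      simp only [Fin.cons_zero, Fin.cons_succ, Complex.ofReal_mul, mul_assoc]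

end RightDeriv

/-! ### 6. Dirac estimates -/

section Dirac

/-- **The Dirac estimate for `G ⋆ (c β)^*`**: if `β ≥ 0` is a probability weight and
`|c(y) G(z y) - c(1) G(z)| ≤ δ` on its support, then `|(G ⋆ (c β)^*)(z) - c(1) G(z)| ≤ δ`
(`norm_integral_mul_sub_le` of `HarishChandraDiracGL`; Borel (1972), 3.4 (1)). [cite: Borel1972, 3.4 (1)] -/
theorem norm_mulConv_mulStar_sub_le {G : G∞ → ℂ} (hG : Continuous G) {c : G∞ → ℝ} (hc : Continuous c)
    {β : G∞ → ℝ} (hβ : Continuous β) (hβs : HasCompactSupport β) (hβ0 : ∀ x, 0 ≤ β x)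
    (hβ1 : ∫ x, β x ∂(archHaar n K) = 1) (z : G∞) {δ : ℝ}
    (hδ : ∀ y, β y ≠ 0 → ‖(c y : ℂ) * G (z * y) - (c 1 : ℂ) * G z‖ ≤ δ) :
    ‖mulConv (archHaar n K) G (mulStar fun y => ((c y * β y : ℝ) : ℂ)) z - (c 1 : ℂ) * G z‖ ≤ δ := by
  have heq : mulConv (archHaar n K) G (mulStar fun y => ((c y * β y : ℝ) : ℂ)) z =
      ∫ y, ((c y : ℂ) * G (z * y)) * (β y : ℂ) ∂(archHaar n K) := by
    rw [mulConv_mulStar_apply']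
    refine integral_congr_ae (ae_of_all _ fun y => ?_)
    simp only [Complex.ofReal_mul, map_mul, Complex.conj_ofReal]
    ring
  rw [heq]
  have hβi : Integrable β (archHaar n K) := hβ.integrable_of_hasCompactSupport hβs
  have hψβ : Integrable (fun y => ((c y : ℂ) * G (z * y)) * (β y : ℂ)) (archHaar n K) :=
    (((Complex.continuous_ofReal.comp hc).mul (hG.comp (continuous_const.mul continuous_id))).mul
      (Complex.continuous_ofReal.comp hβ)).integrable_of_hasCompactSupport
      ((hβs.comp_left Complex.ofReal_zero).mul_left)
  exact norm_integral_mul_sub_le hβ0 hβ1 hβi hψβ hδ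

/-- **Uniform continuity with uniformly compact support**: for `G ∈ C_c(G_∞)` and `c` continuous there
is a compact set `k` such that for every `ε > 0` there is a neighbourhood `U` of `1` with, for all `y ∈ U`:
`|c(y) G(z y) - c(1) G(z)| ≤ ε` for every `z`, and both `G(z y)` and `G(z)` vanish for `z ∉ k`
(uniform continuity of `(y, z) ↦ c(y) G(z y)` transversally to the compact `k = supp G · V⁻¹`,
`IsCompact.mem_uniformity_of_prod`). [folklore] -/
theorem exists_compact_forall_eps_nhds {G : G∞ → ℂ} (hG : Continuous G) (hGs : HasCompactSupport G)
    {c : G∞ → ℝ} (hc : Continuous c) :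
    ∃ k : Set G∞, IsCompact k ∧ ∀ ε : ℝ, 0 < ε → ∃ U ∈ 𝓝 (1 : G∞),
      (∀ y ∈ U, ∀ z, ‖(c y : ℂ) * G (z * y) - (c 1 : ℂ) * G z‖ ≤ ε) ∧
      (∀ y ∈ U, ∀ z, z ∉ k → G (z * y) = 0 ∧ G z = 0) := by
  -- a compact neighbourhood `V` of `1` and the compact `k = supp G · V⁻¹`
  obtain ⟨V, hVc, hV1⟩ := exists_compact_mem_nhds (1 : G∞)
  set k : Set G∞ := tsupport G * V⁻¹ with hk
  have hkc : IsCompact k := hGs.isCompact.mul hVc.inv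
  have hvan : ∀ y ∈ V, ∀ z, z ∉ k → G (z * y) = 0 ∧ G z = 0 := by
    intro y hy z hz
    constructor
    · refine image_eq_zero_of_notMem_tsupport fun h => hz ?_
      exact ⟨z * y, h, y⁻¹, Set.inv_mem_inv.2 hy, mul_inv_cancel_right z y⟩
    · refine image_eq_zero_of_notMem_tsupport fun h => hz ?_
      exact ⟨z, h, 1⁻¹, Set.inv_mem_inv.2 (mem_of_mem_nhds hV1), by simp⟩
  refine ⟨k, hkc, fun ε hε => ?_⟩
  -- transversal uniform continuity of `f y z = c y * G (z y)` on `V × k`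
  set f : G∞ → G∞ → ℂ := fun y z => (c y : ℂ) * G (z * y) with hf
  have hfc : ContinuousOn f.uncurry (V ×ˢ k) :=
    (((Complex.continuous_ofReal.comp hc).comp continuous_fst).mul
      (hG.comp (continuous_snd.mul continuous_fst))).continuousOn
  have hu : {p : ℂ × ℂ | dist p.1 p.2 < ε} ∈ uniformity ℂ := Metric.dist_mem_uniformity hε
  obtain ⟨v, hv, hvε⟩ := hkc.mem_uniformity_of_prod hfc (mem_of_mem_nhds hV1) hu
  obtain ⟨W, hW, hWV⟩ : ∃ W ∈ 𝓝 (1 : G∞), W ∩ V ⊆ v := mem_nhdsWithin_iff_exists_mem_nhds_inter.1 hv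
  refine ⟨W ∩ V, inter_mem hW hV1, fun y hy z => ?_, fun y hy z hz => hvan y hy.2 z hz⟩
  by_cases hz : z ∈ k
  · have h := hvε y (hWV hy) z hz
    simp only [hf, mem_setOf_eq, mul_one, dist_eq_norm] at h
    exact h.le
  · obtain ⟨h1, h2⟩ := hvan y hy.2 z hz
    rw [h1, h2, mul_zero, mul_zero, sub_zero, norm_zero]
    exact hε.le

/-- **The `L¹` Dirac estimate**: under the conclusion of `exists_compact_forall_eps_nhds`, for every
probability weight `β ≥ 0` supported in `U`,
`∫ |(G ⋆ (c β)^*)(z) - c(1) G(z)| dz ≤ ε · vol(k)`. [folklore] -/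
theorem integral_norm_mulConv_mulStar_sub_le {G : G∞ → ℂ} (hG : Continuous G) (hGs : HasCompactSupport G)
    {c : G∞ → ℝ} (hc : Continuous c)
    {ε : ℝ} {U k : Set G∞} (hk : IsCompact k)
    (hU : ∀ y ∈ U, ∀ z, ‖(c y : ℂ) * G (z * y) - (c 1 : ℂ) * G z‖ ≤ ε)
    (hUk : ∀ y ∈ U, ∀ z, z ∉ k → G (z * y) = 0 ∧ G z = 0)
    {β : G∞ → ℝ} (hβ : Continuous β) (hβs : HasCompactSupport β) (hβ0 : ∀ x, 0 ≤ β x)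
    (hβ1 : ∫ x, β x ∂(archHaar n K) = 1) (hβU : Function.support β ⊆ U) :
    ∫ z, ‖mulConv (archHaar n K) G (mulStar fun y => ((c y * β y : ℝ) : ℂ)) z - (c 1 : ℂ) * G z‖ ∂(archHaar n K) ≤
      ε * ((archHaar n K) k).toReal := by
  set Φ : G∞ → ℂ := fun z => mulConv (archHaar n K) G (mulStar fun y => ((c y * β y : ℝ) : ℂ)) z - (c 1 : ℂ) * G z
    with hΦ
  have hpt : ∀ z, ‖Φ z‖ ≤ ε :=
    fun z => norm_mulConv_mulStar_sub_le hG hc hβ hβs hβ0 hβ1 z fun y hy => hU y (hβU (Function.mem_support.2 hy)) z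
  have hzero : ∀ z, z ∉ k → Φ z = 0 := by
    intro z hz
    have h2 : G z = 0 := by
      obtain ⟨y, hy⟩ : ∃ y, β y ≠ 0 := by
        by_contra h
        push Not at h
        have : ∫ x, β x ∂(archHaar n K) = 0 := by simp [funext h]
        rw [hβ1] at this
        exact one_ne_zero this
      exact (hUk y (hβU (Function.mem_support.2 hy)) z hz).2
    simp only [hΦ]
    rw [h2, mul_zero, sub_zero, mulConv_mulStar_apply']
    refine integral_eq_zero_of_ae (ae_of_all _ fun y => ?_)
    by_cases hy : β y = 0
    · simp [hy]
    · change G (z * y) * _ = 0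
      rw [(hUk y (hβU (Function.mem_support.2 hy)) z hz).1, zero_mul]
  have hΦc : Continuous Φ :=
    (continuous_mulConv_mulStar hG hGs (Complex.continuous_ofReal.comp (hc.mul hβ))).sub (continuous_const.mul hG)
  calc ∫ z, ‖Φ z‖ ∂(archHaar n K)
      = ∫ z in k, ‖Φ z‖ ∂(archHaar n K) := by
        rw [setIntegral_eq_integral_of_forall_compl_eq_zero]
        intro z hz
        rw [hzero z hz, norm_zero]
    _ ≤ ∫ z in k, ε ∂(archHaar n K) :=
        setIntegral_mono_on (hΦc.norm.continuousOn.integrableOn_compact hk)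
          (integrableOn_const (hk.measure_lt_top.ne)) hk.measurableSet fun z _ => hpt z
    _ = ε * ((archHaar n K) k).toReal := by
        rw [setIntegral_const, smul_eq_mul, mul_comm]
        rfl

end Dirac

/-! ### 7. Dirac sequences of test functions -/

section DiracSeq

/-- **A Dirac sequence in `C_c^∞(G_∞)`**: non-negative real test functions `β_m` of integral `1` for the
Haar measure `archHaar` whose supports shrink into every neighbourhood of `1` (the normalised invariant
bumps of `exists_dirac_admissibleWeightsGL`; Borel (1972), 3.4). [cite: Borel1972, 3.4] -/
theorem exists_dirac_archTestFunction :
    ∃ β : ℕ → G∞ → ℝ,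
      (∀ m, IsArchTestFunction n K fun x => ((β m x : ℝ) : ℂ)) ∧
      (∀ m, Continuous (β m)) ∧ (∀ m, HasCompactSupport (β m)) ∧ (∀ m x, 0 ≤ β m x) ∧
      (∀ m, ∫ x, β m x ∂(archHaar n K) = 1) ∧
      ∀ U ∈ 𝓝 (1 : G∞), ∀ᶠ m in atTop, Function.support (β m) ⊆ U := by
  obtain ⟨β, hmem, hc, hs, h0, h1, hU⟩ := exists_dirac_admissibleWeightsGL (n := n) (K := K) (archHaar n K)
  exact ⟨β, fun m => IsArchTestFunction.of_mem_admissibleWeightsGL (hmem m), hc, hs, h0, h1, hU⟩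

/-- **Conjugates of a Dirac sequence form a Dirac sequence**: `β_m^u(x) = β_m(u x u⁻¹)` is again
non-negative of integral `1` (unimodularity of `GL_n(K_∞)`), a test function, with supports shrinking to
`1` (conjugation is a homeomorphism fixing `1`). [folklore] -/
theorem dirac_conj {β : ℕ → G∞ → ℝ}
    (hβt : ∀ m, IsArchTestFunction n K fun x => ((β m x : ℝ) : ℂ))
    (hβc : ∀ m, Continuous (β m)) (hβs : ∀ m, HasCompactSupport (β m)) (hβ0 : ∀ m x, 0 ≤ β m x)
    (hβ1 : ∀ m, ∫ x, β m x ∂(archHaar n K) = 1)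
    (hβU : ∀ U ∈ 𝓝 (1 : G∞), ∀ᶠ m in atTop, Function.support (β m) ⊆ U) (u : G∞) :
    (∀ m, IsArchTestFunction n K fun x => ((β m (u * x * u⁻¹) : ℝ) : ℂ)) ∧
      (∀ m, Continuous fun x => β m (u * x * u⁻¹)) ∧ (∀ m, HasCompactSupport fun x => β m (u * x * u⁻¹)) ∧
      (∀ m x, 0 ≤ β m (u * x * u⁻¹)) ∧
      (∀ m, ∫ x, β m (u * x * u⁻¹) ∂(archHaar n K) = 1) ∧
      ∀ U ∈ 𝓝 (1 : G∞), ∀ᶠ m in atTop, (Function.support fun x => β m (u * x * u⁻¹)) ⊆ U := by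
  have hhomeo : ∀ m, (fun x : G∞ => β m (u * x * u⁻¹)) = β m ∘ (Homeomorph.mulLeft u).trans (Homeomorph.mulRight u⁻¹) :=
    fun m => rfl
  refine ⟨fun m => ?_, fun m => (hβc m).comp ((continuous_const.mul continuous_id).mul continuous_const),
    fun m => ?_, fun m x => hβ0 m _, fun m => ?_, fun U hU => ?_⟩
  · have h := ((hβt m).comp_mul_left u).comp_mul_right u⁻¹
    simpa only [mul_assoc] using h
  · rw [hhomeo m]
    exact (hβs m).comp_homeomorph _
  · have h1 : ∫ x, β m (u * x * u⁻¹) ∂(archHaar n K) = ∫ x, β m (x * u⁻¹) ∂(archHaar n K) :=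
      integral_mul_left_eq_self (μ := archHaar n K) (fun x => β m (x * u⁻¹)) u
    rw [h1, integral_mul_right_eq_self_glInf n K (archHaar n K) (β m) u⁻¹, hβ1 m]
  · -- the preimage of `U` under the inverse conjugation is a neighbourhood of `1`
    have hcont : Continuous fun w : G∞ => u⁻¹ * w * u := (continuous_const.mul continuous_id).mul continuous_const
    have hpre : (fun w : G∞ => u⁻¹ * w * u) ⁻¹' U ∈ 𝓝 (1 : G∞) := by
      refine hcont.continuousAt.preimage_mem_nhds ?_
      rwa [mul_one, inv_mul_cancel]
    filter_upwards [hβU _ hpre] with m hm x hx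
    have h := hm (Function.mem_support.2 hx)
    rw [Set.mem_preimage] at h
    simpa only [← mul_assoc, inv_mul_cancel, one_mul, inv_mul_cancel_right] using h

/-- **Dirac sequences in `C_c^∞(G_∞)`** (bundled): non-negative real test functions of integral `1` whose
supports shrink into every neighbourhood of `1` (Borel (1972), 3.4). [cite: Borel1972, 3.4] -/
structure IsDiracSeq (β : ℕ → GL (Fin n) (mixedSpace K) → ℝ) : Prop where
  /-- each `β_m` is a (complexified) test function -/
  test : ∀ m, IsArchTestFunction n K fun x => ((β m x : ℝ) : ℂ)
  /-- continuity -/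
  continuous : ∀ m, Continuous (β m)
  /-- compact support -/
  hasCompactSupport : ∀ m, HasCompactSupport (β m)
  /-- non-negativity -/
  nonneg : ∀ m x, 0 ≤ β m x
  /-- total mass one -/
  integral_eq_one : ∀ m, ∫ x, β m x ∂(archHaar n K) = 1
  /-- supports shrink to `1` -/
  support_subset : ∀ U ∈ 𝓝 (1 : GL (Fin n) (mixedSpace K)), ∀ᶠ m in atTop, Function.support (β m) ⊆ U

/-- Dirac sequences exist. [cite: Borel1972, 3.4] -/
theorem exists_isDiracSeq : ∃ β : ℕ → G∞ → ℝ, IsDiracSeq (n := n) (K := K) β := by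
  obtain ⟨β, ht, hc, hs, h0, h1, hU⟩ := exists_dirac_archTestFunction (n := n) (K := K)
  exact ⟨β, ⟨ht, hc, hs, h0, h1, hU⟩⟩

/-- Conjugates `β_m(u · u⁻¹)` of a Dirac sequence form a Dirac sequence. [folklore] -/
theorem IsDiracSeq.conj {β : ℕ → G∞ → ℝ} (hβ : IsDiracSeq (n := n) (K := K) β) (u : G∞) :
    IsDiracSeq (n := n) (K := K) fun m x => β m (u * x * u⁻¹) := by
  obtain ⟨ht, hc, hs, h0, h1, hU⟩ := dirac_conj hβ.test hβ.continuous hβ.hasCompactSupport hβ.nonneg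
    hβ.integral_eq_one hβ.support_subset u
  exact ⟨ht, hc, hs, h0, h1, hU⟩

end DiracSeq

/-! ### 8. Convergence `L_u R_w (f ⋆ β^*) → L_u R_w f` in `L¹` along a Dirac sequence -/

section Convergence

/-- **Multilinearity of the right words in the basis**: for `X : Fin k → 𝔤𝔩_n(K_∞)`,
`R_{[X₀,…]} f = Σ_{v} (∏_j coord_{v j}(X_j)) · R_{[X_{v 0},…]} f` (`archRightDeriv_sum_smul_left`
iterated; the coefficients are `∏_j adCoord (X j) (v j) 1`). [folklore] -/
theorem archRightWordDeriv_ofFn_eq_sum {f : G∞ → ℂ} (hf : IsArchTestFunction n K f) :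
    ∀ (k : ℕ) (X : Fin k → Mat), archRightWordDeriv (List.ofFn X) f =
      ∑ v : Fin k → Fin (Module.finrank ℝ Mat),
        ((∏ j, adCoord (X j) (v j) (1 : G∞) : ℝ) : ℂ) •
          archRightWordDeriv (List.ofFn fun j => glBasis n K (v j)) f
  | 0, X => by
    rw [List.ofFn_zero, archRightWordDeriv_nil, Fintype.sum_unique]
    simp only [Finset.univ_eq_empty, Finset.prod_empty, Complex.ofReal_one, one_smul, List.ofFn_zero,
      archRightWordDeriv_nil]
  | k + 1, X => by
    rw [List.ofFn_succ, archRightWordDeriv_cons, archRightWordDeriv_ofFn_eq_sum hf k (fun i => X i.succ)]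
    -- `R_{X 0}` through the sum, then expand `X 0 = Σ_b coord_b (X 0) • X_b`
    have hterm : ∀ v : Fin k → Fin (Module.finrank ℝ Mat), IsArchTestFunction n K
        (((∏ j, adCoord (X j.succ) (v j) (1 : G∞) : ℝ) : ℂ) •
          archRightWordDeriv (List.ofFn fun j => glBasis n K (v j)) f) := fun v =>
      (hf.archRightWordDeriv _).smul _
    rw [archRightDeriv_finset_sum _ (fun v _ => hterm v)]
    have hstep : ∀ v : Fin k → Fin (Module.finrank ℝ Mat),
        archRightDeriv (X 0) (((∏ j, adCoord (X j.succ) (v j) (1 : G∞) : ℝ) : ℂ) •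
          archRightWordDeriv (List.ofFn fun j => glBasis n K (v j)) f) =
        ∑ b, (((∏ j, adCoord (X j.succ) (v j) (1 : G∞) : ℝ) : ℂ) * (adCoord (X 0) b 1 : ℂ)) •
          archRightDeriv (glBasis n K b) (archRightWordDeriv (List.ofFn fun j => glBasis n K (v j)) f) := by
      intro v
      rw [archRightDeriv_smul]
      conv_lhs => rw [← sum_adCoord_one_smul (n := n) (K := K) (X 0)]
      rw [(hf.archRightWordDeriv _).archRightDeriv_sum_smul_left, Finset.smul_sum]
      refine Finset.sum_congr rfl fun b _ => ?_
      rw [smul_smul]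
    simp only [hstep]
    rw [Finset.sum_comm, ← (Fin.consEquiv fun _ => Fin (Module.finrank ℝ Mat)).sum_comp, Fintype.sum_prod_type]
    refine Finset.sum_congr rfl fun b _ => Finset.sum_congr rfl fun v _ => ?_
    simp only [Fin.consEquiv_apply]
    rw [List.ofFn_succ, archRightWordDeriv_cons, Fin.prod_univ_succ]
    simp only [Fin.cons_zero, Fin.cons_succ, Complex.ofReal_mul, mul_comm]

/-- Additivity of `L_w` over finite sums of test functions. [folklore] -/
theorem archLeftWordDeriv_finset_sum {ι' : Type*} (s : Finset ι') {F : ι' → G∞ → ℂ}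
    (hF : ∀ i ∈ s, IsArchTestFunction n K (F i)) (w : List Mat) :
    archLeftWordDeriv w (∑ i ∈ s, F i) = ∑ i ∈ s, archLeftWordDeriv w (F i) := by
  classical
  induction s using Finset.induction_on with
  | empty =>
    simp only [Finset.sum_empty]
    induction w with
    | nil => rfl
    | cons X w ih =>
      rw [archLeftWordDeriv_cons, ih]
      funext y
      exact deriv_const (0 : ℝ) (0 : ℂ)
  | insert i s hi ih =>
    have hs : ∀ j ∈ s, IsArchTestFunction n K (F j) := fun j hj => hF j (Finset.mem_insert_of_mem hj)
    rw [Finset.sum_insert hi, Finset.sum_insert hi,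
      (hF i (Finset.mem_insert_self i s)).archLeftWordDeriv_add (IsArchTestFunction.finset_sum s hs) w, ih hs]

/-- `L_w (c • f) = c • L_w f`. [folklore] -/
theorem archLeftWordDeriv_smul' (c : ℂ) (f : G∞ → ℂ) (w : List Mat) :
    archLeftWordDeriv w (c • f) = c • archLeftWordDeriv w f :=
  archLeftWordDeriv_smul c f w

/-- `∫ ‖c • G‖ ≤ |c| · vol(κ) · M` for `G` supported in the compact `κ` with `|G| ≤ M` on it. [folklore] -/
theorem integral_norm_smul_le_of_tsupport_subset {G : G∞ → ℂ} (hG : Continuous G) {κ : Set G∞} (hκ : IsCompact κ)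
    (hGκ : tsupport G ⊆ κ) (c : ℂ) {M : ℝ} (hM : ∀ g, ‖G g‖ ≤ M) :
    ∫ z, ‖(c • G) z‖ ∂(archHaar n K) ≤ ‖c‖ * ((archHaar n K) κ).toReal * M := by
  have hM0 : 0 ≤ M := (norm_nonneg _).trans (hM 1)
  calc ∫ z, ‖(c • G) z‖ ∂(archHaar n K) = ∫ z in κ, ‖(c • G) z‖ ∂(archHaar n K) := by
        rw [setIntegral_eq_integral_of_forall_compl_eq_zero]
        intro z hz
        rw [Pi.smul_apply, image_eq_zero_of_notMem_tsupport (fun h => hz (hGκ h)), smul_zero, norm_zero]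
    _ ≤ ∫ z in κ, ‖c‖ * M ∂(archHaar n K) := by
        refine setIntegral_mono_on ((hG.const_smul c).norm.continuousOn.integrableOn_compact hκ)
          (integrableOn_const hκ.measure_lt_top.ne) hκ.measurableSet fun z _ => ?_
        rw [Pi.smul_apply, _root_.norm_smul]
        exact mul_le_mul_of_nonneg_left (hM z) (norm_nonneg _)
    _ = ‖c‖ * ((archHaar n K) κ).toReal * M := by
        rw [setIntegral_const, smul_eq_mul]
        change ((archHaar n K) κ).toReal * (‖c‖ * M) = _
        ring

/-- **`L_u R_w (f ⋆ β_m^*) → L_u R_w f` in `L¹(G_∞)` along a Dirac sequence** (`w = [X₀, …, X_{k-1}]`):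
by `archRightWordDeriv_mulConv_mulStar_eq_sum` and `archLeftWordDeriv_mulConv_mulStar`,
`L_u R_w (f ⋆ β^*) = Σ_v (L_u R_{B v} f) ⋆ (c_v β)^*`, while `L_u R_w f = Σ_v c_v(1) L_u R_{B v} f`
(`archRightWordDeriv_ofFn_eq_sum`); each term converges by the `L¹` Dirac estimate. [folklore] -/
theorem tendsto_integral_norm_archLeftWordDeriv_archRightWordDeriv_sub {f : G∞ → ℂ} (hf : IsArchTestFunction n K f)
    {β : ℕ → G∞ → ℝ} (hβc : ∀ m, Continuous (β m)) (hβs : ∀ m, HasCompactSupport (β m))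
    (hβ0 : ∀ m x, 0 ≤ β m x) (hβ1 : ∀ m, ∫ x, β m x ∂(archHaar n K) = 1)
    (hβU : ∀ U ∈ 𝓝 (1 : G∞), ∀ᶠ m in atTop, Function.support (β m) ⊆ U)
    (u : List Mat) (k : ℕ) (X : Fin k → Mat) :
    Tendsto (fun m => ∫ z, ‖archLeftWordDeriv u (archRightWordDeriv (List.ofFn X)
        (mulConv (archHaar n K) f (mulStar fun y => ((β m y : ℝ) : ℂ)))) z -
        archLeftWordDeriv u (archRightWordDeriv (List.ofFn X) f) z‖ ∂(archHaar n K)) atTop (𝓝 0) := by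
  set ι' := Fin k → Fin (Module.finrank ℝ Mat)
  -- the pieces `G_v = L_u R_{B v} f` and the coefficients `c_v`
  set G : ι' → G∞ → ℂ := fun v => archLeftWordDeriv u (archRightWordDeriv (List.ofFn fun j => glBasis n K (v j)) f)
    with hG
  set c : ι' → G∞ → ℝ := fun v y => ∏ j, adCoord (X j) (v j) y with hc
  have hGt : ∀ v, IsArchTestFunction n K (G v) := fun v => ((hf.archRightWordDeriv _).archLeftWordDeriv u)
  have hcc : ∀ v, Continuous (c v) := fun v => continuous_finsetProd _ fun j _ => continuous_adCoord _ _
  -- the two expansions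
  have hconv : ∀ m, archLeftWordDeriv u (archRightWordDeriv (List.ofFn X)
      (mulConv (archHaar n K) f (mulStar fun y => ((β m y : ℝ) : ℂ)))) =
      ∑ v, mulConv (archHaar n K) (G v) (mulStar fun y => ((c v y * β m y : ℝ) : ℂ)) := by
    intro m
    have hβC : Continuous fun y => ((β m y : ℝ) : ℂ) := Complex.continuous_ofReal.comp (hβc m)
    have hβS : HasCompactSupport fun y => ((β m y : ℝ) : ℂ) := (hβs m).comp_left Complex.ofReal_zero
    rw [archRightWordDeriv_mulConv_mulStar_eq_sum hf hβC hβS k X]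
    have hterm : ∀ v : ι', IsArchTestFunction n K (mulConv (archHaar n K)
        (archRightWordDeriv (List.ofFn fun j => glBasis n K (v j)) f)
        (mulStar fun y => ((∏ j, adCoord (X j) (v j) y : ℝ) : ℂ) * ((β m y : ℝ) : ℂ))) := fun v =>
      (hf.archRightWordDeriv _).mulConv_mulStar ((Complex.continuous_ofReal.comp (hcc v)).mul hβC) hβS.mul_left
    rw [archLeftWordDeriv_finset_sum _ (fun v _ => hterm v)]
    refine Finset.sum_congr rfl fun v _ => ?_
    have hw : Continuous fun y : G∞ => ((∏ j, adCoord (X j) (v j) y : ℝ) : ℂ) * ((β m y : ℝ) : ℂ) :=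
      (Complex.continuous_ofReal.comp (hcc v)).mul hβC
    have hws : HasCompactSupport fun y : G∞ => ((∏ j, adCoord (X j) (v j) y : ℝ) : ℂ) * ((β m y : ℝ) : ℂ) :=
      hβS.mul_left
    rw [archLeftWordDeriv_mulConv_mulStar (hf.archRightWordDeriv _) hw hws u]
    congr 1
    funext y
    simp only [mulStar_apply, hc, Complex.ofReal_mul]
  have hlim : archLeftWordDeriv u (archRightWordDeriv (List.ofFn X) f) = ∑ v, ((c v 1 : ℝ) : ℂ) • G v := by
    rw [archRightWordDeriv_ofFn_eq_sum hf k X]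
    have hterm : ∀ v : ι', IsArchTestFunction n K ((((∏ j, adCoord (X j) (v j) (1 : G∞) : ℝ) : ℂ)) •
        archRightWordDeriv (List.ofFn fun j => glBasis n K (v j)) f) := fun v => (hf.archRightWordDeriv _).smul _
    rw [archLeftWordDeriv_finset_sum _ (fun v _ => hterm v)]
    refine Finset.sum_congr rfl fun v _ => ?_
    rw [archLeftWordDeriv_smul']
  -- compact sets `k_v` and the `ε`-argument
  have hk : ∀ v : ι', ∃ kv : Set G∞, IsCompact kv ∧ ∀ ε : ℝ, 0 < ε → ∃ U ∈ 𝓝 (1 : G∞),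
      (∀ y ∈ U, ∀ z, ‖(c v y : ℂ) * G v (z * y) - (c v 1 : ℂ) * G v z‖ ≤ ε) ∧
      (∀ y ∈ U, ∀ z, z ∉ kv → G v (z * y) = 0 ∧ G v z = 0) := fun v =>
    exists_compact_forall_eps_nhds (hGt v).continuous (hGt v).hasCompactSupport (hcc v)
  choose kv hkvc hkv using hk
  set Vol : ℝ := ∑ v, ((archHaar n K) (kv v)).toReal with hVol
  have hVol0 : 0 ≤ Vol := Finset.sum_nonneg fun v _ => ENNReal.toReal_nonneg
  rw [Metric.tendsto_atTop]
  intro ε hε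
  set ε' : ℝ := ε / (2 * (Vol + 1)) with hε'
  have hε'0 : 0 < ε' := div_pos hε (by positivity)
  have hU : ∀ v : ι', ∃ U ∈ 𝓝 (1 : G∞),
      (∀ y ∈ U, ∀ z, ‖(c v y : ℂ) * G v (z * y) - (c v 1 : ℂ) * G v z‖ ≤ ε') ∧
      (∀ y ∈ U, ∀ z, z ∉ kv v → G v (z * y) = 0 ∧ G v z = 0) := fun v => hkv v ε' hε'0
  choose U hU1 hUε hUk using hU
  have hUall : (⋂ v, U v) ∈ 𝓝 (1 : G∞) := (Filter.iInter_mem).2 hU1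
  obtain ⟨N, hN⟩ := eventually_atTop.1 (hβU _ hUall)
  refine ⟨N, fun m hm => ?_⟩
  have hsupp : ∀ v, Function.support (β m) ⊆ U v := fun v => (hN m hm).trans (Set.iInter_subset _ v)
  -- the estimate
  have hβC : Continuous fun y => ((β m y : ℝ) : ℂ) := Complex.continuous_ofReal.comp (hβc m)
  have hdiff : ∀ z, archLeftWordDeriv u (archRightWordDeriv (List.ofFn X)
      (mulConv (archHaar n K) f (mulStar fun y => ((β m y : ℝ) : ℂ)))) z -
      archLeftWordDeriv u (archRightWordDeriv (List.ofFn X) f) z =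
      ∑ v, (mulConv (archHaar n K) (G v) (mulStar fun y => ((c v y * β m y : ℝ) : ℂ)) z - ((c v 1 : ℝ) : ℂ) * G v z) := by
    intro z
    rw [hconv m, hlim, Finset.sum_apply, Finset.sum_apply, ← Finset.sum_sub_distrib]
    rfl
  have hint : ∀ v, Integrable (fun z => ‖mulConv (archHaar n K) (G v) (mulStar fun y => ((c v y * β m y : ℝ) : ℂ)) z -
      ((c v 1 : ℝ) : ℂ) * G v z‖) (archHaar n K) := by
    intro v
    have hcont : Continuous fun z => mulConv (archHaar n K) (G v) (mulStar fun y => ((c v y * β m y : ℝ) : ℂ)) z -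
        ((c v 1 : ℝ) : ℂ) * G v z :=
      (continuous_mulConv_mulStar (hGt v).continuous (hGt v).hasCompactSupport
        (Complex.continuous_ofReal.comp ((hcc v).mul (hβc m)))).sub (continuous_const.mul (hGt v).continuous)
    refine (hcont.norm).integrable_of_hasCompactSupport ?_
    refine ((hasCompactSupport_mulConv_mulStar (hGt v).hasCompactSupport
      (((hβs m).mul_left).comp_left Complex.ofReal_zero)).sub ((hGt v).hasCompactSupport.mul_left)).norm
  rw [dist_zero_right, Real.norm_eq_abs, abs_of_nonneg (integral_nonneg fun z => norm_nonneg _)]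
  calc ∫ z, ‖archLeftWordDeriv u (archRightWordDeriv (List.ofFn X)
          (mulConv (archHaar n K) f (mulStar fun y => ((β m y : ℝ) : ℂ)))) z -
          archLeftWordDeriv u (archRightWordDeriv (List.ofFn X) f) z‖ ∂(archHaar n K)
      ≤ ∫ z, ∑ v, ‖mulConv (archHaar n K) (G v) (mulStar fun y => ((c v y * β m y : ℝ) : ℂ)) z -
          ((c v 1 : ℝ) : ℂ) * G v z‖ ∂(archHaar n K) := by
        refine integral_mono_of_nonneg (ae_of_all _ fun z => norm_nonneg _) (integrable_finsetSum _ fun v _ => hint v)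
          (ae_of_all _ fun z => ?_)
        dsimp only
        rw [hdiff z]
        exact norm_sum_le _ _
    _ = ∑ v, ∫ z, ‖mulConv (archHaar n K) (G v) (mulStar fun y => ((c v y * β m y : ℝ) : ℂ)) z -
          ((c v 1 : ℝ) : ℂ) * G v z‖ ∂(archHaar n K) := integral_finsetSum _ fun v _ => hint v
    _ ≤ ∑ v, ε' * ((archHaar n K) (kv v)).toReal := Finset.sum_le_sum fun v _ =>
        integral_norm_mulConv_mulStar_sub_le (hGt v).continuous (hGt v).hasCompactSupport (hcc v) (hkvc v)
          (hUε v) (hUk v) (hβc m) (hβs m) (hβ0 m) (hβ1 m) (hsupp v)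
    _ = ε' * Vol := by rw [hVol, Finset.mul_sum]
    _ < ε := by
        rw [hε', div_mul_eq_mul_div, div_lt_iff₀ (by positivity)]
        nlinarith [hVol0, hε]

end Convergence

/-! ### 9. Reflection `f̌(g) = f(g⁻¹)`: `(L_w f)̌ = R_w f̌`, `(a ⋆ b)̌ = b̌ ⋆ ǎ`, `L_X (β ⋆ ψ) = (L_X β) ⋆ ψ` -/

section Reflection

/-- **`(L_X f)(y⁻¹) = (R_X f̌)(y)`** with `f̌(g) = f(g⁻¹)`: `f(exp(-sX) y⁻¹) = f̌(y exp(sX))`. [folklore] -/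
theorem archLeftDeriv_apply_inv (X : Mat) (f : G∞ → ℂ) (y : G∞) :
    archLeftDeriv X f y⁻¹ = archRightDeriv X (fun g => f g⁻¹) y := by
  unfold archLeftDeriv archRightDeriv
  refine congrArg (fun F : ℝ → ℂ => deriv F 0) (funext fun s => ?_)
  simp only [mul_inv_rev]

/-- **`(L_w f)(y⁻¹) = (R_w f̌)(y)`** for every word `w`. [folklore] -/
theorem archLeftWordDeriv_apply_inv (f : G∞ → ℂ) :
    ∀ (w : List Mat) (y : G∞), archLeftWordDeriv w f y⁻¹ = archRightWordDeriv w (fun g => f g⁻¹) y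
  | [], y => rfl
  | X :: w, y => by
    rw [archLeftWordDeriv_cons, archRightWordDeriv_cons, archLeftDeriv_apply_inv]
    refine congrArg (fun F : G∞ → ℂ => archRightDeriv X F y) (funext fun g => ?_)
    exact archLeftWordDeriv_apply_inv f w g

/-- The Haar measure `archHaar` of `GL_n(K_∞)` is inversion invariant (unimodularity,
`isMulRightInvariant_of_isHaarMeasure_glInf`). [folklore] -/
theorem isInvInvariant_archHaar : (archHaar n K).IsInvInvariant := by
  haveI := isMulRightInvariant_of_isHaarMeasure_glInf n K (archHaar n K)
  exact isInvInvariant_of_isMulRightInvariant (archHaar n K)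

/-- **`(a ⋆ b)(z⁻¹) = (b̌ ⋆ ǎ)(z)`**: reflection is an anti-automorphism of the convolution algebra
(`∫ a(x) b(x⁻¹ z⁻¹) dx = ∫ b(x⁻¹) a(z⁻¹ x) dx`, substitution `x ↦ z⁻¹ x`). [folklore] -/
theorem mulConv_apply_inv (a b : G∞ → ℂ) (z : G∞) :
    mulConv (archHaar n K) a b z⁻¹ = mulConv (archHaar n K) (fun g => b g⁻¹) (fun g => a g⁻¹) z := by
  rw [mulConv_apply, mulConv_apply, ← integral_mul_left_eq_self _ z⁻¹]
  refine integral_congr_ae (ae_of_all _ fun x => ?_)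
  simp only [mul_inv_rev, inv_inv, mul_inv_cancel_right]
  ring

/-- `∫ ‖F(z⁻¹)‖ dz = ∫ ‖F(z)‖ dz` (inversion invariance of `archHaar`). [folklore] -/
theorem integral_norm_comp_inv (F : G∞ → ℂ) :
    ∫ z, ‖F z⁻¹‖ ∂(archHaar n K) = ∫ z, ‖F z‖ ∂(archHaar n K) := by
  haveI := isInvInvariant_archHaar (n := n) (K := K)
  exact integral_inv_eq_self (fun z => ‖F z‖) (archHaar n K)

/-- **`L_X (β ⋆ ψ) = (L_X β) ⋆ ψ`** for `β` a test function and `ψ` continuous of compact support: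
`(β ⋆ ψ)(exp(-sX) z) = ∫ β(exp(-sX) x) ψ(x⁻¹ z) dx` (substitution `x ↦ exp(-sX) x`), differentiated under
the integral sign over the compact `z (supp ψ)⁻¹`. Deitmar–Echterhoff (2014), Lemma 1.6.3
(`L_y(f * g) = (L_y f) * g`). [folklore] -/
theorem archLeftDeriv_mulConv_left {β ψ : G∞ → ℂ} (hβ : IsArchTestFunction n K β) (hψ : Continuous ψ)
    (hψs : HasCompactSupport ψ) (X : Mat) :
    archLeftDeriv X (mulConv (archHaar n K) β ψ) = mulConv (archHaar n K) (archLeftDeriv X β) ψ := by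
  funext z
  -- the compact set `z (supp ψ)⁻¹` carrying the integrands (`ψ(x⁻¹ z) ≠ 0 ⟹ x ∈ z (supp ψ)⁻¹`)
  set κ : Set G∞ := (fun y => z * y⁻¹) '' tsupport ψ with hκ
  have hκc : IsCompact κ := hψs.isCompact.image (continuous_const.mul continuous_inv)
  have hκcl : IsClosed κ := hκc.isClosed
  have hvan : ∀ x, x ∉ κ → ψ (x⁻¹ * z) = 0 := fun x hx =>
    image_eq_zero_of_notMem_tsupport fun h => hx ⟨x⁻¹ * z, h, by
      show z * (x⁻¹ * z)⁻¹ = x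
      rw [mul_inv_rev, inv_inv, mul_inv_cancel_left]⟩
  set ν : Measure G∞ := (archHaar n K).restrict κ with hν
  haveI : IsFiniteMeasure ν := ⟨by rw [hν, Measure.restrict_apply_univ]; exact hκc.measure_lt_top⟩
  set F : ℝ → G∞ → ℂ := fun s x => β ((expGL (s • X))⁻¹ * x) * ψ (x⁻¹ * z) with hF
  set F' : ℝ → G∞ → ℂ := fun s x => archLeftDeriv X β ((expGL (s • X))⁻¹ * x) * ψ (x⁻¹ * z) with hF'
  have hflow : Continuous fun p : ℝ × G∞ => ((expGL (p.1 • X))⁻¹ * p.2 : G∞) :=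
    ((continuous_expGL_smul X).comp continuous_fst).inv.mul continuous_snd
  have hψz : Continuous fun p : ℝ × G∞ => ψ (p.2⁻¹ * z) := hψ.comp (continuous_snd.inv.mul continuous_const)
  have hFc : Continuous fun p : ℝ × G∞ => F p.1 p.2 := (hβ.continuous.comp hflow).mul hψz
  have hF'c : Continuous fun p : ℝ × G∞ => F' p.1 p.2 := ((hβ.archLeftDeriv X).continuous.comp hflow).mul hψz
  obtain ⟨M, hM⟩ := exists_bound_on_closedBall_prod hF'c hκc
  have hmeas : ∀ s, AEStronglyMeasurable (F s) ν := fun s =>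
    (hFc.comp (continuous_const.prodMk continuous_id)).aestronglyMeasurable
  have hint : Integrable (F 0) ν := by
    rw [hν]; exact (hFc.comp (continuous_const.prodMk continuous_id)).continuousOn.integrableOn_compact hκc
  have hbound : ∀ᵐ x ∂ν, ∀ s ∈ Metric.ball (0 : ℝ) 1, ‖F' s x‖ ≤ M := by
    rw [hν, ae_restrict_iff' hκcl.measurableSet]
    exact ae_of_all _ fun x hx s hs => hM s (Metric.ball_subset_closedBall hs) x hx
  have hdiff : ∀ᵐ x ∂ν, ∀ s ∈ Metric.ball (0 : ℝ) 1, HasDerivAt (fun s => F s x) (F' s x) s :=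
    ae_of_all _ fun x s _ => (hβ.hasDerivAt_left X x s).mul_const _
  have key := (hasDerivAt_integral_of_dominated_loc_of_deriv_le (μ := ν) (Metric.ball_mem_nhds (0 : ℝ) one_pos)
    (Eventually.of_forall hmeas) hint ((hF'c.comp (continuous_const.prodMk continuous_id)).aestronglyMeasurable)
    hbound (integrable_const M) hdiff).2
  -- `(β ⋆ ψ)(exp(-sX) z) = ∫ F s` by the substitution `x ↦ exp(-sX) x`
  have hLHS : (fun s : ℝ => mulConv (archHaar n K) β ψ ((expGL (s • X))⁻¹ * z)) = fun s => ∫ x, F s x ∂ν := by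
    funext s
    rw [mulConv_apply, ← integral_mul_left_eq_self _ (expGL (s • X))⁻¹, hν,
      setIntegral_eq_integral_of_forall_compl_eq_zero]
    · refine integral_congr_ae (ae_of_all _ fun x => ?_)
      simp only [hF, mul_inv_rev, inv_inv, mul_assoc, mul_inv_cancel_left]
    · intro x hx
      simp only [hF, hvan x hx, mul_zero]
  have hRHS : ∫ x, F' 0 x ∂ν = mulConv (archHaar n K) (archLeftDeriv X β) ψ z := by
    rw [mulConv_apply, hν, setIntegral_eq_integral_of_forall_compl_eq_zero]
    · refine integral_congr_ae (ae_of_all _ fun x => ?_)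
      simp only [hF', zero_smul, expGL_zero, inv_one, one_mul]
    · intro x hx
      change archLeftDeriv X β ((expGL ((0 : ℝ) • X))⁻¹ * x) * ψ (x⁻¹ * z) = 0
      rw [hvan x hx, mul_zero]
  show deriv (fun s : ℝ => mulConv (archHaar n K) β ψ ((expGL (s • X))⁻¹ * z)) 0 = _
  rw [hLHS, key.deriv, hRHS]

/-- **`L_w (β ⋆ ψ) = (L_w β) ⋆ ψ`** for every word `w`. [folklore] -/
theorem archLeftWordDeriv_mulConv_left {β ψ : G∞ → ℂ} (hβ : IsArchTestFunction n K β) (hψ : Continuous ψ)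
    (hψs : HasCompactSupport ψ) :
    ∀ w : List Mat, archLeftWordDeriv w (mulConv (archHaar n K) β ψ) = mulConv (archHaar n K) (archLeftWordDeriv w β) ψ
  | [] => rfl
  | X :: w => by
    rw [archLeftWordDeriv_cons, archLeftWordDeriv_mulConv_left hβ hψ hψs w, archLeftWordDeriv_cons,
      archLeftDeriv_mulConv_left (hβ.archLeftWordDeriv w) hψ hψs X]

/-- The left derivatives of a REAL test function are real: `conj (L_w β) = L_w β`. [folklore] -/
theorem conj_archLeftWordDeriv_ofReal {β : G∞ → ℝ} (hβ : IsArchTestFunction n K fun x => ((β x : ℝ) : ℂ)) :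
    ∀ (w : List Mat) (y : G∞), conj (archLeftWordDeriv w (fun x => ((β x : ℝ) : ℂ)) y) =
      archLeftWordDeriv w (fun x => ((β x : ℝ) : ℂ)) y
  | [], y => Complex.conj_ofReal _
  | X :: w, y => by
    rw [archLeftWordDeriv_cons]
    -- `L_X F = conj ∘ L_X F` when `F = conj ∘ F` (derivative of the conjugate)
    have hF := hβ.archLeftWordDeriv w
    have hreal : (fun g => conj (archLeftWordDeriv w (fun x => ((β x : ℝ) : ℂ)) g)) =
        archLeftWordDeriv w (fun x => ((β x : ℝ) : ℂ)) := funext (conj_archLeftWordDeriv_ofReal hβ w)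
    have h1 := HasDerivAt.cconj (hF.hasDerivAt_left X y 0)
    simp only [zero_smul, expGL_zero, inv_one, one_mul] at h1
    have h2 : (fun t : ℝ => conj (archLeftWordDeriv w (fun x => ((β x : ℝ) : ℂ)) ((expGL (t • X))⁻¹ * y))) =
        fun t : ℝ => archLeftWordDeriv w (fun x => ((β x : ℝ) : ℂ)) ((expGL (t • X))⁻¹ * y) :=
      funext fun t => conj_archLeftWordDeriv_ofReal hβ w _
    rw [h2] at h1
    have h3 := (hF.hasDerivAt_left X y 0)
    simp only [zero_smul, expGL_zero, inv_one, one_mul] at h3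
    exact h1.unique h3

end Reflection

end Literature.NumberTheory.Automorphic
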